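import Summits.Ventures.PercRepro.Conjectures

/-!
# PercRepro — C-005 beyond graphs: the abstract lattice form and Conjecture N (typer-2, gen 2)

`conjectures/C-005.md` §Addendum 2 and §Addendum 4 (lead): replace the marked partition of a graph
by ANY monotone map `c : Config E → Setoid (Fin 4)` from a cube with a product measure into the
partition lattice of four indices.

* `cross4 i` — the three crossing two-block partitions `ab|cd`, `ac|bd`, `ad|bc` (as the kernels of
  the engine rows `0011`, `0101`, `0110`);
* `nestedForm p c c' = N(c, c') = μ(c'=⊤)μ(c=⊥) + μ(c=⊤)μ(c'=⊥) − Σ_{i≠j} μ(c'=x_i)μ(c=x_j)`;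
* **`C005abstract`** (Addendum 2): `0 ≤ N(c, c)` for every monotone `c` — `N(c, c) = 2·(top·bot − e₂(x))`;
* **`ConjectureN`** (Addendum 4): `0 ≤ N(c, c')` for every nested pair `c ≤ c'` of monotone maps;
* `C005abstract_of_ConjectureN`, **`C005_of_C005abstract`** (the marked partition `ω ↦ Π(ω)` is
  monotone and its cells are the engine rows): `ConjectureN → C005abstract → C005`.
Conjecture N also contains p3's `CrossTermNonneg` (`c = c⁰`, `c' = c¹`, the cells with one edge
forced closed / open), hence C-005 through p3's reduction — the named target of attempt A.
-/

namespace PercRepro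

open Finset

/-- The three crossing two-block partitions of four indices: `ab|cd`, `ac|bd`, `ad|bc`. -/
def cross4 : Fin 3 → Setoid (Fin 4) :=
  ![Setoid.ker ![0, 0, 1, 1], Setoid.ker ![0, 1, 0, 1], Setoid.ker ![0, 1, 1, 0]]

/-- `N(c, c')` of C-005.md Addendum 4 for two maps into the partition lattice. -/
noncomputable def nestedForm {E : Type*} [Fintype E] [DecidableEq E] (p : E → ℝ)
    (c c' : Config E → Setoid (Fin 4)) : ℝ :=
  prob p {ω | c' ω = ⊤} * prob p {ω | c ω = ⊥} + prob p {ω | c ω = ⊤} * prob p {ω | c' ω = ⊥} -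
    ∑ i : Fin 3, ∑ j : Fin 3,
      if i ≠ j then prob p {ω | c' ω = cross4 i} * prob p {ω | c ω = cross4 j} else 0

/-- **The abstract (lattice) form of C-005** (C-005.md §Addendum 2): for every product measure on a
cube and every monotone map `c` into the partitions of four indices,
`μ(c = ⊤)·μ(c = ⊥) ≥ Σ_{i<j} μ(c = x_i)·μ(c = x_j)` (here as `0 ≤ N(c, c) = 2·(top·bot − e₂)`). -/
def C005abstract : Prop :=
  ∀ {E : Type} [Fintype E] [DecidableEq E] (p : E → ℝ), IsProb p →
    ∀ c : Config E → Setoid (Fin 4), Monotone c → 0 ≤ nestedForm p c c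

/-- **Conjecture N** (C-005.md §Addendum 4): `N(c, c') ≥ 0` for every nested pair `c ≤ c'` of
monotone maps into the partitions of four indices. -/
def ConjectureN : Prop :=
  ∀ {E : Type} [Fintype E] [DecidableEq E] (p : E → ℝ), IsProb p →
    ∀ c c' : Config E → Setoid (Fin 4), Monotone c → Monotone c' → c ≤ c' → 0 ≤ nestedForm p c c'

/-- Conjecture N contains the abstract form (`c = c'`). -/
theorem C005abstract_of_ConjectureN (h : ConjectureN) : C005abstract :=
  fun p hp c hc => h p hp c c hc hc le_rfl

/-- The kernel of the constant labels `0000` is the one-block partition. -/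
theorem Setoid.ker_rgs4_top : Setoid.ker (![0, 0, 0, 0] : Fin 4 → ℕ) = ⊤ :=
  Setoid.ext fun a b => by
    rw [Setoid.ker_def]
    exact ⟨fun _ => trivial, fun _ => by fin_cases a <;> fin_cases b <;> rfl⟩

/-- The kernel of the injective labels `0123` is the discrete partition. -/
theorem Setoid.ker_rgs4_bot : Setoid.ker (![0, 1, 2, 3] : Fin 4 → ℕ) = ⊥ :=
  Setoid.ext fun a b => by
    rw [Setoid.ker_def]
    constructor
    · intro h
      fin_cases a <;> fin_cases b <;> simp_all
    · rintro rfl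
      rfl

namespace MultiGraph

variable {V E : Type*} (G : MultiGraph V E) [Fintype E] [DecidableEq E]

omit [Fintype E] [DecidableEq E] in
/-- The marked partition of four vertices is a monotone map into the partition lattice. -/
theorem monotone_markedPartition_four (m : Fin 4 → V) :
    Monotone fun ω : Config E => G.markedPartition ω m :=
  G.markedPartition_mono m

/-- `N(Π, Π)` at the marked partition of `a, b, c, d` is twice the C-005 defect in engine rows. -/
theorem nestedForm_markedPartition (p : E → ℝ) (a b c d : V) :
    nestedForm p (fun ω => G.markedPartition ω ![a, b, c, d]) (fun ω => G.markedPartition ω ![a, b, c, d]) =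
      2 * (prob p (G.partitionEvent ![a, b, c, d] ![0, 0, 0, 0]) *
            prob p (G.partitionEvent ![a, b, c, d] ![0, 1, 2, 3]) -
          (prob p (G.partitionEvent ![a, b, c, d] ![0, 0, 1, 1]) *
              prob p (G.partitionEvent ![a, b, c, d] ![0, 1, 0, 1]) +
            prob p (G.partitionEvent ![a, b, c, d] ![0, 0, 1, 1]) *
              prob p (G.partitionEvent ![a, b, c, d] ![0, 1, 1, 0]) +
            prob p (G.partitionEvent ![a, b, c, d] ![0, 1, 0, 1]) *
              prob p (G.partitionEvent ![a, b, c, d] ![0, 1, 1, 0]))) := by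
  have hT : {ω : Config E | G.markedPartition ω ![a, b, c, d] = ⊤} =
      G.partitionEvent ![a, b, c, d] ![0, 0, 0, 0] := by
    rw [G.partitionEvent_eq_partitionSetoidEvent, Setoid.ker_rgs4_top]
    rfl
  have hB : {ω : Config E | G.markedPartition ω ![a, b, c, d] = ⊥} =
      G.partitionEvent ![a, b, c, d] ![0, 1, 2, 3] := by
    rw [G.partitionEvent_eq_partitionSetoidEvent, Setoid.ker_rgs4_bot]
    rfl
  have hx : ∀ i : Fin 3, {ω : Config E | G.markedPartition ω ![a, b, c, d] = cross4 i} =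
      G.partitionEvent ![a, b, c, d] (![![0, 0, 1, 1], ![0, 1, 0, 1], ![0, 1, 1, 0]] i) := by
    intro i
    rw [G.partitionEvent_eq_partitionSetoidEvent]
    fin_cases i <;> rfl
  simp only [nestedForm, hT, hB, hx, Fin.sum_univ_succ, Fin.sum_univ_zero]
  simp
  ring

/-- **The abstract form implies C-005.** -/
theorem C005_of_C005abstract (h : C005abstract) : C005 := by
  intro V E _ _ G p hp a b c d
  have := h p hp (fun ω => G.markedPartition ω ![a, b, c, d]) (G.monotone_markedPartition_four _)
  rw [G.nestedForm_markedPartition] at this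
  linarith

end MultiGraph

/-- **Conjecture N implies C-005.** -/
theorem C005_of_ConjectureN (h : ConjectureN) : C005 :=
  MultiGraph.C005_of_C005abstract (C005abstract_of_ConjectureN h)

/-! ### C-009: the cubic Gladkov inequality, general form (mine-3's M3-C1g) -/

/-- `e₃` of a finite vector: the sum over triples `i < j < l` of the products. -/
def e3Vec {n : ℕ} (v : Fin n → ℝ) : ℝ :=
  ∑ i : Fin n, ∑ j : Fin n, ∑ l : Fin n, if i < j ∧ j < l then v i * v j * v l else 0

/-- **Gladkov's setting** (BLMS 2024 Thm 2.1): the cube is partitioned into cells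
`cell 0 = A`, `cell 1 = B`, `cell (i+2) = C_i` (pairwise disjoint, covering), with every `A ∪ C_i`
an up-set. -/
structure GladkovSetting {E : Type*} {m : ℕ} (cell : Fin (m + 2) → Set (Config E)) : Prop where
  disjoint : Pairwise fun i j => Disjoint (cell i) (cell j)
  cover : ⋃ i, cell i = Set.univ
  upper : ∀ i : Fin m, IsUpperSet (cell 0 ∪ cell i.succ.succ)

/-- **C-009** (mine-3's M3-C1g, `conjectures/C-009.md`; CONJECTURES v12): the CUBIC Gladkov
inequality in Gladkov's abstract setting — for every product measure on a cube and every
partition `A ⊔ C₁ ⊔ … ⊔ C_m ⊔ B` with `A ∪ C_i` up-sets,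
`μ(A)·μ(B) ≥ e₃(μ(A), μ(B), μ(C₁), …, μ(C_m))` (equivalently
`(μA + μB)(μA·μB − e₂(c)) ≥ e₃(c)`). Gladkov's theorem is the `e₂` statement; C-007 (`m = 3`,
`k = 3` cells) and C-008 (`m = 7`, the two-block cells of four vertices) are its percolation
instances; Lemma C(r) (three-copy class form) proves it uniformly. -/
def C009 : Prop :=
  ∀ {E : Type} [Fintype E] [DecidableEq E] (p : E → ℝ), IsProb p →
    ∀ (m : ℕ) (cell : Fin (m + 2) → Set (Config E)), GladkovSetting cell →
      e3Vec (fun i => prob p (cell i)) ≤ prob p (cell 0) * prob p (cell 1)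

end PercRepro
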